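import Mathlib.RepresentationTheory.Subrepresentation
import Mathlib.RepresentationTheory.Intertwining
import Mathlib.RepresentationTheory.Irreducible
import Mathlib.RingTheory.Finiteness.Basic
import Mathlib.LinearAlgebra.Finsupp.LinearCombination
import Mathlib.LinearAlgebra.Quotient.Basic
import Literature.NumberTheory.Automorphic.IrreducibleClasses
import Literature.NumberTheory.Automorphic.MatrixCoefficientsTrivialRep
import HarnessLib

/-!
# Quotient representations, irreducible quotients, transport and twists
(first sibling proof file towards `Literature.NumberTheory.Automorphic.bernsteinZelevinsky_support`)

Generic representation theory used in the proof of the existence of the supercuspidal support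
(Bernstein–Zelevinsky 1977, Thm. 2.5; Bernstein–Zelevinsky 1976, Ch. II–III), none of it specific
to `GL_n`:

* `Subrepresentation.quotientRep N` — the representation on `V ⧸ N` (Mathlib
  `Representation.quotient`) by a subrepresentation `N`, its quotient map `Subrepresentation.mkQ`
  (a surjective intertwining map), and `Subrepresentation.isIrreducible_quotientRep`: the
  quotient by a **coatom** of the lattice of subrepresentations is irreducible;
* `Representation.exists_isCoatom_subrepresentation`: a representation which is finitely
  generated as a module over the group algebra and non-zero has a coatom among its
  subrepresentations (Mathlib: `IsCoatomic (Submodule k[G] _)` for finite modules), and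
  `Representation.finite_asModule_of_span_orbit_eq_top`: finite generation over `k[G]` from a
  finite set whose `G`-orbit spans;
* `Representation.IsSmooth.quotientRep`: quotients of smooth representations are smooth;
* `Representation.conjRep ρ e` — transport of structure along a linear equivalence
  `e : V ≃ₗ W`, with the isomorphism `Representation.conjRepEquiv`, `Representation.Equiv.isSmooth`,
  and `Representation.IsIrreducible.exists_equiv_quotient_finsupp`: an irreducible representation
  of `G` is isomorphic to one on a quotient of `G →₀ k` (so its isomorphism class has a
  representative in the universe of `G` and `k`);
* `Representation.IsSupercuspidal.twist`: supercuspidality (compact support of smooth matrix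
  coefficients modulo the centre, `Representation.IsSupercuspidal`) is preserved by twisting with
  a smooth character (Bushnell–Henniart 2006, §10.1: the coefficients are multiplied by `χ`; the
  smooth contragredients agree by `Representation.mem_contragredient_twist` of
  `MatrixCoefficientsTrivialRep` and its converse `mem_contragredient_of_twist`).

All statements are standard (Bernstein–Zelevinsky 1976, §2; Bushnell–Henniart 2006, §§1–2, 9–10)
and tagged folklore. The declarations in `namespace Representation` / `namespace Subrepresentation`
are deliberate dot-notation extensions of the Mathlib namespaces, as in the other files of this
directory (`IrreducibleClasses`, `SmoothRepresentation`).

## References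

* I. N. Bernstein, A. V. Zelevinsky, *Representations of the group `GL(n, F)` where `F` is a
  non-archimedean local field*, Russian Math. Surveys 31:3 (1976), §2.
* I. N. Bernstein, A. V. Zelevinsky, *Induced representations of reductive `p`-adic groups I*,
  Ann. Sci. ÉNS 10 (1977), Thm. 2.5.
* C. J. Bushnell, G. Henniart, *The local Langlands conjecture for `GL(2)`* (2006), §§1–2, 9–10.
-/

open scoped MonoidAlgebra Pointwise

/-! ### Quotient of a representation by a subrepresentation -/

namespace Subrepresentation

section Quotient

variable {k G V : Type*} [CommRing k] [Monoid G] [AddCommGroup V] [Module k V]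
  {ρ : Representation k G V}

/-- A subrepresentation is stable under every `ρ g` (restatement of `apply_mem_toSubmodule` in
the form consumed by `Representation.quotient`). [folklore] -/
lemma le_comap_toSubmodule (N : Subrepresentation ρ) (g : G) :
    N.toSubmodule ≤ N.toSubmodule.comap (ρ g) :=
  fun _ hv => N.apply_mem_toSubmodule g hv

/-- The **quotient representation** `V ⧸ N` of `ρ` by a subrepresentation `N` (Mathlib's
`Representation.quotient` applied to the `G`-stable submodule `N`).
(Bernstein–Zelevinsky 1976, §2.1; Bushnell–Henniart 2006, §1.1.) [folklore] -/
def quotientRep (N : Subrepresentation ρ) : Representation k G (V ⧸ N.toSubmodule) :=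
  ρ.quotient N.toSubmodule N.le_comap_toSubmodule

/-- The quotient representation acts by `g • [v] = [ρ g v]`. [folklore] -/
@[simp] lemma quotientRep_mk (N : Subrepresentation ρ) (g : G) (v : V) :
    N.quotientRep g (Submodule.Quotient.mk v) = Submodule.Quotient.mk (ρ g v) :=
  rfl

/-- The **quotient map** `V → V ⧸ N` as an intertwining map `ρ → N.quotientRep`. [folklore] -/
def mkQ (N : Subrepresentation ρ) : ρ.IntertwiningMap N.quotientRep where
  toLinearMap := N.toSubmodule.mkQ
  isIntertwining' _ := rfl

/-- `N.mkQ v = [v]`. [folklore] -/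
@[simp] lemma mkQ_apply (N : Subrepresentation ρ) (v : V) :
    N.mkQ v = Submodule.Quotient.mk v :=
  rfl

/-- The quotient map is surjective. [folklore] -/
lemma mkQ_surjective (N : Subrepresentation ρ) : Function.Surjective N.mkQ :=
  Submodule.Quotient.mk_surjective _

/-- The kernel of the quotient map on vectors: `N.mkQ v = 0 ↔ v ∈ N`. [folklore] -/
lemma mkQ_eq_zero_iff (N : Subrepresentation ρ) (v : V) : N.mkQ v = 0 ↔ v ∈ N :=
  Submodule.Quotient.mk_eq_zero _

/-- Pull-back of a subrepresentation of the quotient `V ⧸ N` to a subrepresentation of `V`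
containing `N`. [folklore] -/
def comapMkQ (N : Subrepresentation ρ) (S : Subrepresentation N.quotientRep) :
    Subrepresentation ρ where
  toSubmodule := S.toSubmodule.comap N.toSubmodule.mkQ
  apply_mem_toSubmodule g v hv := by
    simp only [Submodule.mem_comap, Submodule.mkQ_apply] at hv ⊢
    rw [← quotientRep_mk]
    exact S.apply_mem_toSubmodule g hv

/-- `N ≤ N.comapMkQ S`. [folklore] -/
lemma le_comapMkQ (N : Subrepresentation ρ) (S : Subrepresentation N.quotientRep) :
    N ≤ N.comapMkQ S := by
  intro v hv
  change N.toSubmodule.mkQ v ∈ S.toSubmodule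
  rw [Submodule.mkQ_apply, (Submodule.Quotient.mk_eq_zero _).2 hv]
  exact S.toSubmodule.zero_mem

end Quotient

section Irreducible

variable {k G V : Type*} [Field k] [Monoid G] [AddCommGroup V] [Module k V]
  {ρ : Representation k G V}

/-- **The quotient by a coatom is irreducible**: if `N` is a coatom of the lattice of
subrepresentations of `ρ` (a maximal proper subrepresentation), then `V ⧸ N` is an irreducible
representation — a subrepresentation of `V ⧸ N` pulls back to a subrepresentation of `V`
containing `N`, which is `N` or `V`. (Bernstein–Zelevinsky 1976, §2.1; Bushnell–Henniart 2006,
§1.1; Mathlib `isSimpleModule_iff_isCoatom` is the module-theoretic form.) [folklore] -/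
theorem isIrreducible_quotientRep {N : Subrepresentation ρ} (hN : IsCoatom N) :
    N.quotientRep.IsIrreducible := by
  have hbot_ne_top : (⊥ : Subrepresentation N.quotientRep) ≠ ⊤ := by
    intro h
    apply hN.1
    refine le_antisymm le_top fun v _ => ?_
    have hv : N.mkQ v ∈ (⊤ : Subrepresentation N.quotientRep) := trivial
    rw [← h] at hv
    have hv' : N.mkQ v = 0 := (Submodule.mem_bot k).1 hv
    exact (N.mkQ_eq_zero_iff v).1 hv'
  refine { exists_pair_ne := ⟨⊥, ⊤, hbot_ne_top⟩, eq_bot_or_eq_top := fun S => ?_ }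
  rcases eq_or_lt_of_le (N.le_comapMkQ S) with h | h
  · -- `comap S = N`: then `S = ⊥`
    left
    refine le_antisymm (fun x hx => ?_) bot_le
    obtain ⟨v, rfl⟩ := N.mkQ_surjective x
    have hv : v ∈ N.comapMkQ S := hx
    rw [← h] at hv
    change N.mkQ v ∈ (⊥ : Subrepresentation N.quotientRep)
    rw [(N.mkQ_eq_zero_iff v).2 hv]
    exact (⊥ : Subrepresentation N.quotientRep).toSubmodule.zero_mem
  · -- `comap S = ⊤`: then `S = ⊤`
    right
    have htop : N.comapMkQ S = ⊤ := hN.2 _ h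
    refine le_antisymm le_top fun x _ => ?_
    obtain ⟨v, rfl⟩ := N.mkQ_surjective x
    have hv : v ∈ N.comapMkQ S := by rw [htop]; trivial
    exact hv

end Irreducible

end Subrepresentation

namespace Representation

/-! ### Coatoms from finite generation over the group algebra -/

section Coatom

variable {k G V : Type*} [CommRing k] [Monoid G] [AddCommGroup V] [Module k V]
  (ρ : Representation k G V)

/-- A representation which is **finitely generated over `k[G]`** and non-zero has a maximal
proper subrepresentation (a coatom of `Subrepresentation ρ`): the lattice of `k[G]`-submodules of
a finite module is coatomic (Mathlib), and it is order-isomorphic to the lattice of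
subrepresentations (`Subrepresentation.subrepresentationSubmoduleOrderIso`).
(Bernstein–Zelevinsky 1976, §2.1–2.2: a finitely generated representation has an irreducible
quotient.) [folklore] -/
theorem exists_isCoatom_subrepresentation [Module.Finite k[G] ρ.asModule] [Nontrivial V] :
    ∃ N : Subrepresentation ρ, IsCoatom N := by
  haveI : Nontrivial ρ.asModule := inferInstanceAs (Nontrivial V)
  have hbt : (⊥ : Submodule k[G] ρ.asModule) ≠ ⊤ := bot_ne_top
  rcases IsCoatomic.eq_top_or_exists_le_coatom (⊥ : Submodule k[G] ρ.asModule) with h | ⟨m, hm, -⟩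
  · exact absurd h hbt
  · refine ⟨Subrepresentation.subrepresentationSubmoduleOrderIso.symm m, ?_⟩
    rw [← OrderIso.isCoatom_iff
      (Subrepresentation.subrepresentationSubmoduleOrderIso (ρ := ρ)), OrderIso.apply_symm_apply]
    exact hm

/-- **Finite generation over `k[G]` from a finite set whose orbit spans**: if the `k`-span of
the `G`-translates `ρ g x` of the elements `x` of a finite set `s` is all of `V`, then `V` is a
finitely generated `k[G]`-module (generated by `s`). [folklore] -/
theorem finite_asModule_of_span_orbit_eq_top {s : Set V} (hs : s.Finite)
    (hspan : Submodule.span k {w | ∃ g : G, ∃ x ∈ s, w = ρ g x} = ⊤) :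
    Module.Finite k[G] ρ.asModule := by
  refine Module.finite_def.2 ⟨(hs.image ρ.asModuleEquiv.symm).toFinset, ?_⟩
  rw [Set.Finite.coe_toFinset]
  refine eq_top_iff.2 fun v _ => ?_
  have hv : ρ.asModuleEquiv v ∈ Submodule.span k {w | ∃ g : G, ∃ x ∈ s, w = ρ g x} := by
    rw [hspan]; trivial
  have key : ∀ w ∈ Submodule.span k {w | ∃ g : G, ∃ x ∈ s, w = ρ g x},
      ρ.asModuleEquiv.symm w ∈ Submodule.span k[G] (ρ.asModuleEquiv.symm '' s) := by
    intro w hw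
    induction hw using Submodule.span_induction with
    | mem w hw =>
      obtain ⟨g, x, hx, rfl⟩ := hw
      rw [asModuleEquiv_symm_map_rho]
      exact Submodule.smul_mem _ _ (Submodule.subset_span ⟨x, hx, rfl⟩)
    | zero => rw [map_zero]; exact Submodule.zero_mem _
    | add x y _ _ hx hy => rw [map_add]; exact Submodule.add_mem _ hx hy
    | smul c x _ hx =>
      rw [asModuleEquiv_symm_map_smul]
      exact Submodule.smul_mem _ _ hx
  simpa using key _ hv

end Coatom

/-! ### Smoothness of quotients -/

section SmoothQuotient

variable {k G V : Type*} [CommRing k] [Group G] [TopologicalSpace G] [SeparatelyContinuousMul G]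
  [AddCommGroup V] [Module k V] {ρ : Representation k G V}

/-- A quotient of a smooth representation is smooth: the stabiliser of `[v]` contains the (open)
stabiliser of `v`. (Bernstein–Zelevinsky 1976, §2.1.) [folklore] -/
theorem IsSmooth.quotientRep (hρ : ρ.IsSmooth) (N : Subrepresentation ρ) :
    N.quotientRep.IsSmooth := by
  intro x
  obtain ⟨v, rfl⟩ := N.mkQ_surjective x
  refine N.quotientRep.isSmoothVector_of_le (hρ v) fun g hg => ?_
  rw [mem_stabilizerSubgroup] at hg ⊢
  rw [Subrepresentation.mkQ_apply, Subrepresentation.quotientRep_mk, hg]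

end SmoothQuotient

/-! ### Transport of structure along a linear equivalence -/

section Conj

variable {k G V W : Type*} [CommRing k] [Monoid G] [AddCommGroup V] [Module k V]
  [AddCommGroup W] [Module k W]

/-- **Transport of a representation along a linear equivalence** `e : V ≃ₗ[k] W`:
`g ↦ e ∘ ρ g ∘ e⁻¹` on `W`. [folklore] -/
def conjRep (ρ : Representation k G V) (e : V ≃ₗ[k] W) : Representation k G W where
  toFun g := (e : V →ₗ[k] W) ∘ₗ ρ g ∘ₗ (e.symm : W →ₗ[k] V)
  map_one' := by
    ext w
    simp
  map_mul' g h := by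
    ext w
    simp

/-- `ρ.conjRep e g w = e (ρ g (e.symm w))`. [folklore] -/
@[simp] lemma conjRep_apply (ρ : Representation k G V) (e : V ≃ₗ[k] W) (g : G) (w : W) :
    ρ.conjRep e g w = e (ρ g (e.symm w)) :=
  rfl

/-- The transported representation is isomorphic to the original one via `e`. [folklore] -/
def conjRepEquiv (ρ : Representation k G V) (e : V ≃ₗ[k] W) : ρ.Equiv (ρ.conjRep e) :=
  Equiv.mk e fun g => by
    ext v
    simp

/-- `ρ.conjRepEquiv e` is `e` on vectors. [folklore] -/
@[simp] lemma conjRepEquiv_apply (ρ : Representation k G V) (e : V ≃ₗ[k] W) (v : V) :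
    ρ.conjRepEquiv e v = e v :=
  rfl

end Conj

section SmoothEquiv

variable {k G V W : Type*} [CommRing k] [Group G] [TopologicalSpace G] [AddCommGroup V]
  [Module k V] [AddCommGroup W] [Module k W] {ρ : Representation k G V}
  {σ : Representation k G W}

/-- Smoothness transports along an isomorphism of representations: the stabiliser of `φ v` in
`σ` equals the stabiliser of `v` in `ρ`. (Bushnell–Henniart 2006, §1.1. The same statement is
proved as `Representation.IsSmooth.of_equiv` in `LocalLanglandsGLProofs`, whose import cone —
local Langlands for `GL_n` — is kept out of this file; hence the separate name.) [folklore] -/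
theorem Equiv.isSmooth (φ : ρ.Equiv σ) (h : ρ.IsSmooth) : σ.IsSmooth := by
  intro w
  have hset : (σ.stabilizerSubgroup w : Set G) = (ρ.stabilizerSubgroup (φ.symm w) : Set G) := by
    ext g
    simp only [SetLike.mem_coe, mem_stabilizerSubgroup]
    constructor
    · intro hg
      have h1 := φ.symm.toIntertwiningMap.isIntertwining σ ρ g w
      rw [Equiv.coe_toIntertwiningMap] at h1
      rw [← h1, hg]
    · intro hg
      have h1 := φ.toIntertwiningMap.isIntertwining ρ σ g (φ.symm w)
      rw [Equiv.coe_toIntertwiningMap, Equiv.apply_symm_apply, hg, Equiv.apply_symm_apply] at h1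
      exact h1.symm
  rw [IsSmoothVector, hset]
  exact h _

end SmoothEquiv

/-! ### A representative of an irreducible representation on a quotient of `G →₀ k` -/

section Small

variable {k G V : Type*} [Field k] [Group G] [AddCommGroup V] [Module k V]
  (ρ : Representation k G V)

/-- The `k`-linear map `(G →₀ k) → V`, `δ_g ↦ ρ g v` (Mathlib `Finsupp.linearCombination`).
[folklore] -/
noncomputable def orbitCombination (v : V) : (G →₀ k) →ₗ[k] V :=
  Finsupp.linearCombination k fun g => ρ g v

/-- `orbitCombination ρ v δ_g = ρ g v`. [folklore] -/
@[simp] lemma orbitCombination_single (v : V) (g : G) (c : k) :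
    ρ.orbitCombination v (Finsupp.single g c) = c • ρ g v := by
  simp [orbitCombination]

/-- The range of `δ_g ↦ ρ g v` is a subrepresentation (the one generated by `v`):
`ρ h (∑ c_g ρ g v) = ∑ c_g ρ (h g) v`. [folklore] -/
noncomputable def orbitSpan (v : V) : Subrepresentation ρ where
  toSubmodule := LinearMap.range (ρ.orbitCombination v)
  apply_mem_toSubmodule h w hw := by
    obtain ⟨f, rfl⟩ := hw
    induction f using Finsupp.induction_linear with
    | zero => simp
    | add f₁ f₂ h₁ h₂ =>
      rw [map_add, map_add]
      exact Submodule.add_mem _ h₁ h₂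
    | single g c =>
      refine ⟨Finsupp.single (h * g) c, ?_⟩
      rw [orbitCombination_single, orbitCombination_single, map_smul, map_mul, Module.End.mul_apply]

/-- For `ρ` irreducible and `v ≠ 0`, the map `δ_g ↦ ρ g v` is onto (its range is a non-zero
subrepresentation). [folklore] -/
theorem orbitCombination_surjective [ρ.IsIrreducible] {v : V} (hv : v ≠ 0) :
    Function.Surjective (ρ.orbitCombination v) := by
  have hne : ρ.orbitSpan v ≠ ⊥ := by
    intro h
    have hv' : v ∈ ρ.orbitSpan v := ⟨Finsupp.single 1 1, by simp⟩
    rw [h] at hv'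
    exact hv ((Submodule.mem_bot k).1 hv')
  have htop : ρ.orbitSpan v = ⊤ := (IsSimpleOrder.eq_bot_or_eq_top _).resolve_left hne
  intro w
  have hw : w ∈ ρ.orbitSpan v := by rw [htop]; trivial
  exact hw

/-- **Every irreducible representation of `G` over `k` is isomorphic to a representation on a
quotient of `G →₀ k`** (namely `(G →₀ k) ⧸ ker (δ_g ↦ ρ g v)` for any `v ≠ 0`, with the
transported action). In particular its isomorphism class has a representative whose carrier
lives in the universes of `G` and `k` only. [folklore] -/
theorem IsIrreducible.exists_equiv_quotient_finsupp [ρ.IsIrreducible] :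
    ∃ (N : Submodule k (G →₀ k)) (σ : Representation k G ((G →₀ k) ⧸ N)), Nonempty (ρ.Equiv σ) := by
  -- `V ≠ 0`
  have hnt : (⊥ : Subrepresentation ρ) ≠ ⊤ := bot_ne_top
  obtain ⟨v, hv⟩ : ∃ v : V, v ≠ 0 := by
    by_contra h
    apply hnt
    refine le_antisymm bot_le fun w _ => ?_
    have hw : w = 0 := not_not.1 ((not_exists.1 h) w)
    rw [hw]
    exact (⊥ : Subrepresentation ρ).toSubmodule.zero_mem
  let e := (ρ.orbitCombination v).quotKerEquivOfSurjective (ρ.orbitCombination_surjective hv)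
  exact ⟨LinearMap.ker (ρ.orbitCombination v), ρ.conjRep e.symm, ⟨ρ.conjRepEquiv e.symm⟩⟩

end Small

/-! ### Twisting by a smooth character preserves supercuspidality -/

section Twist

variable {k G V : Type*} [CommRing k] [Group G] [TopologicalSpace G] [SeparatelyContinuousMul G]
  [AddCommGroup V] [Module k V] (ρ : Representation k G V)

/-- A smooth linear form for `ρ ⊗ χ` (`χ` a smooth character) is one for `ρ = (ρ ⊗ χ) ⊗ χ⁻¹`
(converse of `Representation.mem_contragredient_twist` of `MatrixCoefficientsTrivialRep`).
[folklore] -/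
lemma mem_contragredient_of_twist {χ : G →* kˣ} (hχ : IsOpen (χ.ker : Set G))
    {f : Module.Dual k V} (hf : f ∈ (ρ.twist χ).contragredient) : f ∈ ρ.contragredient := by
  have hker : ((χ⁻¹ : G →* kˣ).ker : Set G) = χ.ker := by
    ext g
    simp [MonoidHom.mem_ker]
  have h := (ρ.twist χ).mem_contragredient_twist (χ := χ⁻¹) (by rw [hker]; exact hχ) hf
  have h1 : χ * χ⁻¹ = 1 := by
    ext g
    simp
  rwa [twist_twist, h1, twist_one] at h

/-- **Twisting by a smooth character preserves supercuspidality**: the smooth linear forms of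
`ρ ⊗ χ` are those of `ρ`, and `c^{ρ ⊗ χ}_{f,v} = χ · c^{ρ}_{f,v}` has the same support.
(Bushnell–Henniart 2006, §10.1; Bernstein–Zelevinsky 1976, §3.) [folklore] -/
theorem IsSupercuspidal.twist (h : ρ.IsSupercuspidal) (χ : G →* kˣ)
    (hχ : IsOpen (χ.ker : Set G)) : (ρ.twist χ).IsSupercuspidal := by
  intro f hf v
  obtain ⟨C, hC, hsupp⟩ := h f (ρ.mem_contragredient_of_twist hχ hf) v
  refine ⟨C, hC, fun g hg => hsupp ?_⟩
  rw [Function.mem_support] at hg ⊢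
  rw [matrixCoeff_twist] at hg
  exact right_ne_zero_of_mul hg

end Twist

end Representation
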